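import Summits.BirchSwinnertonDyer.BirchSwinnertonDyer.Theorems.KimAtThreeDeepUpperPortOfZetaBody
import Summits.BirchSwinnertonDyer.BirchSwinnertonDyer.Theorems.KimAtThreePortSharedC2Supply
import HarnessLib

/-!
# Crux `KatoKuriharaPortThreeShared` (stmt-BirchSwinnertonDyer-19560) FROM THE FINE KATO PACKAGE (C1)
# ALONE — the residual (C3) "anomalous bad places" DISCHARGED by THEOREM D-u
# (cell `bsd-addord`, seat w2-c3 gen 5; route W2 `KimAtThreeKolyvagin`, crux 19076 `DeepUpperAtThree`,
# §U child 19560; kim3 p448445 / p451219, w2-c3 gen 4 p457409, this seat's D-u chain)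

HONEST FRAMING: theorems only (no definition, no named fact, no `sorry`); nothing is booked; BSD is
not proved by any of this.  The last theorem has the crux's type BY NAME but takes (C1) — the FINE KATO
PACKAGE (Kato's `ZetaBody` family for `P.f` WITH the finite-level dual-exponential riders
`KatoExpStarFiniteLevelAt` and the `ω`-normalisation of Kato's constant; kim3 memo KIM3-W2-PORT-g10 /
KIM3-W2-C1-g11: the conclusion of the PUBLISHED fact `Kato2004.exists_eulerSystem_expStar_values`
strengthened by exactly n1011's (P-EXP) rider + R-κ) — as a DISPLAYED hypothesis, so it does NOT close
19560: it makes (C1) the crux's ONLY residual input.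

## What

kim3's p448445 reduced the crux to (C1) + (C2) certificate supply + (C3) the crux on the rows with a
`3`-anomalous bad place `w ≠ 3` (THEOREM D's `hbad`; 79.4 % of the Kato stratum, census j255378);
w2-c3 gen 4 (p456153–p457409) made (C2′) — hence (C2) — a class-wide THEOREM
(`KimAtThreePortSharedC2Supply.unitMinusSymbol_classwide`, Manin relation + `im Λ_f = ℤΩ⁻/2` +
Chebotarev).  THIS FILE removes (C3): `portShared_row_of_fineKato_of_certSupply` is kim3's
`portShared_row_of_fineKato_of_certSupply_of_noAnomalous` with `hbad` DELETED, through the seat's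
★ PK-6₂-u ∘ T-PK6-VDIS (`KimAtThreeDeepUpperPortOfZetaBody`) on THEOREM D-u
(`KimAtThreeDeepUpperKolyvaginPair` ⟸ `…BadPlaceClause` ⟸ `…BadPlaceCondition` ⟸
`…BadPlaceDescent` = n1011-p15's T-DER-BU U5: Kolyvagin's derivative classes of an Euler system
UNRAMIFIED above `w` are `𝓕_u`-valued at `w`, [MR04] Remark A.5 — the unramifiedness being conjunct
(C2) of Kato's `ZetaBody`, Kato (8.1.3)); then
`katoKuriharaPortThreeShared_of_fineKato_of_certSupply : C1 → C2 → crux` and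
**`katoKuriharaPortThreeShared_of_fineKato : C1 → KatoKuriharaPortThreeShared`**.

References: K. Kato, Astérisque 295 (2004) (8.1.3), Prop. 8.12, §9.4, Thm. 9.7, Thm. 6.6 (1), Ex. 13.3;
C.-H. Kim, AJM 148 = arXiv:2203.12159 Thm. 3.13; B. Mazur, K. Rubin, Mem. AMS 799 (2004) Thm. 3.2.4,
App. A Remark A.5; K. Rubin, *Euler Systems* (2000) Thm. 4.5.1; kim3 memos KIM3-W2-PORT-g10,
KIM3-W2-C1-g11; w2-c3 memos W2C3-C2PRIME-CLASSWIDE-g4, W2C3-C3-LOCAL-ANALYSIS-g4.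
-/

noncomputable section

-- the cell's Theorems namespace `Summit.BirchSwinnertonDyer.BirchSwinnertonDyer.…` repeats the summit name by design (D-0017)
set_option linter.dupNamespace false

open scoped NumberField TensorProduct Classical
open Field Finset IsDedekindDomain NumberField WeierstrassCurve Rat.HeightOneSpectrum
open Literature.NumberTheory.GaloisRepresentations Literature.NumberTheory.GaloisCohomology
open Literature.NumberTheory.GaloisRepresentations.DiscreteGaloisModule
open Literature.NumberTheory.EllipticCurves Literature.NumberTheory.EllipticCurves.ModularForms
open Literature.NumberTheory.EllipticCurves.Rank1Residual
open Literature.NumberTheory.EllipticCurves.Kato2004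
open Literature.NumberTheory.EllipticCurves.Kato2004.EulerSystemValues
open Summit.BirchSwinnertonDyer.Rank1Residual.GaloisImage
open Summit.BirchSwinnertonDyer.BirchSwinnertonDyer.Theorems

namespace Summit.BirchSwinnertonDyer.BirchSwinnertonDyer.Theorems.KimAtThreeDeepUpperPortSharedOfFineKato

/-! ### §1. PORT″ at EVERY Kato-stratum row from (C1) + (C2) — no `hbad` -/

/-- **PORT″ at a Kato-stratum row from the FINE KATO PACKAGE (C1) and the CERTIFICATE SUPPLY (C2),
rows WITH a `3`-anomalous bad place INCLUDED** — every binder of the crux `KatoKuriharaPortThreeShared`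
VERBATIM (no `hbad`) gives `KatoKuriharaPortThreeAtWith₂ W 0 v₃ η P`, by ★ PK-6₂-u ∘ T-PK6-VDIS on
THEOREM D-u with `ht0`, `hpN`, `hirr` and the Tate-module instance binders discharged as in kim3's
p448445.  (C1)/(C2) displayed; nothing is booked.
[cite: Kato2004Asterisque, (8.1.3) (p. 180), Prop. 8.12 (p. 186), §9.4 and Thm. 9.7 (pp. 188–189), Thm. 6.6 (1) (p. 163), Ex. 13.3 (pp. 224–225)]
[cite: Kim2022StructureSelmer, Thm. 3.13 and §3.3–§3.4.1] [cite: MazurRubin2004, Thm. 3.2.4 and App. A Remark A.5] -/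
theorem portShared_row_of_fineKato_of_certSupply
    (hC1 : ∀ (W : WeierstrassCurve ℚ) [W.IsElliptic] [W.IsGloballyMinimal]
      [ContinuousSMul ℤ_[3] (W.tateModule 3)] [Module.Free ℤ_[3] (W.tateModule 3)]
      [Module.Finite ℤ_[3] (W.tateModule 3)],
      (∀ m : ℕ, W.HasSurjectiveModNGaloisRep (3 ^ m : ℕ)) →
      (haveI : Fact (Nat.Prime 3) := ⟨Nat.prime_three⟩; Addv W 3) →
      ¬ 3 ∣ (W.baseChange ℚ_[3]).localTamagawaNumber ℤ_[3] →
      Nat.card {Q : (W.baseChange ℚ_[3]).toAffine.Point // (3 : ℕ) • Q = 0} = 1 →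
      ∀ (v₃ : HeightOneSpectrum (𝓞 ℚ)), ((3 : ℕ) : 𝓞 ℚ) ∈ v₃.asIdeal →
      ∀ {N : ℕ} [NeZero N] (P : ModularParametrizationData W N), N = W.conductorNorm ℤ →
        (∀ z ∈ P.L.lattice, ∃ w ∈ periodLattice P.f, z = P.c * w) →
        ¬ (3 : ℤ) ∣ P.maninConstant →
        ∃ (ι : (n : ℕ) → (CyclotomicField n ℚ →+* ℂ)) (κK : ℝ)
          (Λ : ∀ (k' : ℕ) (r : Finset (HeightOneSpectrum (𝓞 ℚ))),
            H1 (tateRep W 3) (cycSubgroup 3 k' r) →ₗ[ℤ_[3]]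
              ℚ_[3] ⊗[ℚ] CyclotomicField (cycLevel 3 k' r) ℚ)
          (Λfin : ∀ j : ℕ, galoisCohomology
            ((W.torsionGaloisModule (((3 : ℕ) : ℤ) ^ j * ((3 : ℕ) : ℤ))).toLocal (Sum.inr v₃)) 1 →+
              ZMod (3 ^ (j + 1))),
          κK ≠ 0 ∧ (∃ u : ℚ, (u : ℝ) = κK ∧ padicValRat 3 u = 0) ∧
          (∀ j : ℕ, KatoExpStarFiniteLevelAt W 3 j 0 v₃ Λ (Λfin j)) ∧
          ∀ (c d a : ℤ) (A : ℕ), 0 < A → Int.gcd c (6 * 3 * A) = 1 → Int.gcd d (6 * 3 * N) = 1 →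
            ∃ (z : ∀ (k' : ℕ) (r : (cyclotomicLevelsRat 3 (badPlaces c d A N)).Ideals),
                  H1 (tateRep W 3) ((cyclotomicLevelsRat 3 (badPlaces c d A N)).level k' r.1))
              (x : ∀ (k' : ℕ) (r : (cyclotomicLevelsRat 3 (badPlaces c d A N)).Ideals),
                  CyclotomicField (cycLevel 3 k' r.1) ℚ),
              ZetaBody W 3 P.f ι κK Λ c d a A z x)
    (hC2 : ∀ (W : WeierstrassCurve ℚ) [W.IsElliptic] [W.IsGloballyMinimal],
      (∀ m : ℕ, W.HasSurjectiveModNGaloisRep (3 ^ m : ℕ)) →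
      (haveI : Fact (Nat.Prime 3) := ⟨Nat.prime_three⟩; Addv W 3) →
      ¬ 3 ∣ (W.baseChange ℚ_[3]).localTamagawaNumber ℤ_[3] →
      Nat.card {Q : (W.baseChange ℚ_[3]).toAffine.Point // (3 : ℕ) • Q = 0} = 1 →
      ∀ {N : ℕ} [NeZero N] (P : ModularParametrizationData W N), N = W.conductorNorm ℤ →
        (∀ z ∈ P.L.lattice, ∃ w ∈ periodLattice P.f, z = P.c * w) →
        ¬ (3 : ℤ) ∣ P.maninConstant →
        ∃ (c d a : ℤ) (A : ℕ) (d' : ℤ) (aM : ℕ → ℤ),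
          0 < A ∧ Int.gcd c (6 * 3 * A) = 1 ∧ Int.gcd d (6 * 3 * N) = 1 ∧
          (∀ q : ℕ, q.Prime → q ≡ 1 [MOD 3] → ¬ q ∣ 2 * c.natAbs * d.natAbs * A) ∧
          Int.gcd (c * d) A = 1 ∧ d * d' ≡ 1 [ZMOD (A : ℤ)] ∧ Nat.Coprime A N ∧
          (∀ q ∈ (3 * A).primeFactors, cuspCoeff P.f q = aM q) ∧
          (∏ q ∈ (3 * A).primeFactors,
              (1 - (aM q : ℚ) / q + (if q ∣ N then 0 else (1 / q : ℚ))) ≠ 0) ∧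
          padicValRat 3 (∏ q ∈ (3 * A).primeFactors,
              (1 - (aM q : ℚ) / q + (if q ∣ N then 0 else (1 / q : ℚ)))) = 0 ∧
          ((c : ℚ) ^ 2 * (d : ℚ) ^ 2 * ratMinusSymbol P.f ((a : ℚ) / A) -
              (c : ℚ) * (d : ℚ) ^ 2 * ratMinusSymbol P.f ((a * c : ℚ) / A) -
              (c : ℚ) ^ 2 * (d : ℚ) * ratMinusSymbol P.f ((a * d' : ℚ) / A) +
              (c : ℚ) * (d : ℚ) * ratMinusSymbol P.f ((a * c * d' : ℚ) / A) ≠ 0) ∧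
          padicValRat 3 ((c : ℚ) ^ 2 * (d : ℚ) ^ 2 * ratMinusSymbol P.f ((a : ℚ) / A) -
              (c : ℚ) * (d : ℚ) ^ 2 * ratMinusSymbol P.f ((a * c : ℚ) / A) -
              (c : ℚ) ^ 2 * (d : ℚ) * ratMinusSymbol P.f ((a * d' : ℚ) / A) +
              (c : ℚ) * (d : ℚ) * ratMinusSymbol P.f ((a * c * d' : ℚ) / A)) = 0)
    (W : WeierstrassCurve ℚ) [W.IsElliptic] [W.IsGloballyMinimal]
    (htow : ∀ m : ℕ, W.HasSurjectiveModNGaloisRep (3 ^ m : ℕ))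
    (hadd : haveI : Fact (Nat.Prime 3) := ⟨Nat.prime_three⟩; Addv W 3)
    (hc3 : ¬ 3 ∣ (W.baseChange ℚ_[3]).localTamagawaNumber ℤ_[3])
    (ht : Nat.card {Q : (W.baseChange ℚ_[3]).toAffine.Point // (3 : ℕ) • Q = 0} = 1)
    (v₃ : HeightOneSpectrum (𝓞 ℚ)) (hv₃ : ((3 : ℕ) : 𝓞 ℚ) ∈ v₃.asIdeal)
    (η : (q : HeightOneSpectrum (𝓞 ℚ)) → (ZMod (Ideal.absNorm q.asIdeal))ˣ)
    {N : ℕ} [NeZero N] (P : ModularParametrizationData W N) (hN : N = W.conductorNorm ℤ)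
    (hlat : ∀ z ∈ P.L.lattice, ∃ w ∈ periodLattice P.f, z = P.c * w)
    (hman : ¬ (3 : ℤ) ∣ P.maninConstant) :
    KatoKuriharaPortThreeAtWith₂ W 0 v₃ η P := by
  haveI : Fact (Nat.Prime 3) := ⟨Nat.prime_three⟩
  haveI : ContinuousSMul ℤ_[3] (W.tateModule 3) := TateModule.continuousSMul_padicInt
  haveI : Module.Free ℤ_[3] (W.tateModule 3) := W.module_free_tateModule_holds 3
  haveI : Module.Finite ℤ_[3] (W.tateModule 3) := W.module_finite_tateModule_holds 3
  obtain ⟨c, d, a, A, d', aM, hA, hcA, hdN, hcdA, hcd, hdd', hAN, haM, hE0, hE, hR0, hR⟩ :=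
    hC2 W htow hadd hc3 ht P hN hlat hman
  haveI : NeZero A := ⟨hA.ne'⟩
  obtain ⟨ι, κK, Λ, Λfin, hκ0, hNorm, hfin, hz⟩ := hC1 W htow hadd hc3 ht v₃ hv₃ P hN hlat hman
  obtain ⟨z, x, hbody⟩ := hz c d a A hA hcA hdN
  have hirr : W.HasIrreducibleModPGaloisRep 3 := KimAtThreeKolyvaginPortShared.hasIrreducibleModPGaloisRep_three_of_tower W htow
  have hpN : 3 ^ 2 ∣ N := hN ▸ KimAtThreeKolyvaginPortShared.sq_dvd_conductorNorm_of_addv W hadd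
  have ht0 : ∀ w : HeightOneSpectrum (𝓞 ℚ), ((3 : ℕ) : 𝓞 ℚ) ∈ w.asIdeal →
      ∀ Q : (W.baseChange (w.adicCompletion ℚ)).toAffine.Point, 3 • Q = 0 → Q = 0 :=
    fun w hw => KimAtThreeKolyvaginPortShared.forall_torsion_three_eq_zero_adicCompletion_of_natCard_eq_one W ht w hw
  exact KimAtThreeDeepUpperPortOfZetaBody.katoKuriharaPortThreeAtWith₂_zero_of_zetaBody_of_valueRows_of_unramified
    W P hN hbody Λfin hfin hcdA ht0 hirr hNorm hκ0 d' hcd hdd' hAN hpN aM haM hE0 hE hR0 hR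

/-! ### §2. The crux BY NAME from (C1) + (C2), and from (C1) alone -/

/-- **Crux `KatoKuriharaPortThreeShared` BY NAME from (C1) + (C2)** (kim3's three-input reduction
p448445 with (C3) REMOVED by THEOREM D-u): every row is served by §1.
[cite: Kato2004Asterisque, (8.1.3) (p. 180), Prop. 8.12 (p. 186), §9.4 and Thm. 9.7 (pp. 188–189), Thm. 6.6 (1) (p. 163), Ex. 13.3 (pp. 224–225)]
[cite: MazurRubin2004, Thm. 3.2.4 and App. A Remark A.5] -/
theorem katoKuriharaPortThreeShared_of_fineKato_of_certSupply
    (hC1 : ∀ (W : WeierstrassCurve ℚ) [W.IsElliptic] [W.IsGloballyMinimal]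
      [ContinuousSMul ℤ_[3] (W.tateModule 3)] [Module.Free ℤ_[3] (W.tateModule 3)]
      [Module.Finite ℤ_[3] (W.tateModule 3)],
      (∀ m : ℕ, W.HasSurjectiveModNGaloisRep (3 ^ m : ℕ)) →
      (haveI : Fact (Nat.Prime 3) := ⟨Nat.prime_three⟩; Addv W 3) →
      ¬ 3 ∣ (W.baseChange ℚ_[3]).localTamagawaNumber ℤ_[3] →
      Nat.card {Q : (W.baseChange ℚ_[3]).toAffine.Point // (3 : ℕ) • Q = 0} = 1 →
      ∀ (v₃ : HeightOneSpectrum (𝓞 ℚ)), ((3 : ℕ) : 𝓞 ℚ) ∈ v₃.asIdeal →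
      ∀ {N : ℕ} [NeZero N] (P : ModularParametrizationData W N), N = W.conductorNorm ℤ →
        (∀ z ∈ P.L.lattice, ∃ w ∈ periodLattice P.f, z = P.c * w) →
        ¬ (3 : ℤ) ∣ P.maninConstant →
        ∃ (ι : (n : ℕ) → (CyclotomicField n ℚ →+* ℂ)) (κK : ℝ)
          (Λ : ∀ (k' : ℕ) (r : Finset (HeightOneSpectrum (𝓞 ℚ))),
            H1 (tateRep W 3) (cycSubgroup 3 k' r) →ₗ[ℤ_[3]]
              ℚ_[3] ⊗[ℚ] CyclotomicField (cycLevel 3 k' r) ℚ)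
          (Λfin : ∀ j : ℕ, galoisCohomology
            ((W.torsionGaloisModule (((3 : ℕ) : ℤ) ^ j * ((3 : ℕ) : ℤ))).toLocal (Sum.inr v₃)) 1 →+
              ZMod (3 ^ (j + 1))),
          κK ≠ 0 ∧ (∃ u : ℚ, (u : ℝ) = κK ∧ padicValRat 3 u = 0) ∧
          (∀ j : ℕ, KatoExpStarFiniteLevelAt W 3 j 0 v₃ Λ (Λfin j)) ∧
          ∀ (c d a : ℤ) (A : ℕ), 0 < A → Int.gcd c (6 * 3 * A) = 1 → Int.gcd d (6 * 3 * N) = 1 →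
            ∃ (z : ∀ (k' : ℕ) (r : (cyclotomicLevelsRat 3 (badPlaces c d A N)).Ideals),
                  H1 (tateRep W 3) ((cyclotomicLevelsRat 3 (badPlaces c d A N)).level k' r.1))
              (x : ∀ (k' : ℕ) (r : (cyclotomicLevelsRat 3 (badPlaces c d A N)).Ideals),
                  CyclotomicField (cycLevel 3 k' r.1) ℚ),
              ZetaBody W 3 P.f ι κK Λ c d a A z x)
    (hC2 : ∀ (W : WeierstrassCurve ℚ) [W.IsElliptic] [W.IsGloballyMinimal],
      (∀ m : ℕ, W.HasSurjectiveModNGaloisRep (3 ^ m : ℕ)) →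
      (haveI : Fact (Nat.Prime 3) := ⟨Nat.prime_three⟩; Addv W 3) →
      ¬ 3 ∣ (W.baseChange ℚ_[3]).localTamagawaNumber ℤ_[3] →
      Nat.card {Q : (W.baseChange ℚ_[3]).toAffine.Point // (3 : ℕ) • Q = 0} = 1 →
      ∀ {N : ℕ} [NeZero N] (P : ModularParametrizationData W N), N = W.conductorNorm ℤ →
        (∀ z ∈ P.L.lattice, ∃ w ∈ periodLattice P.f, z = P.c * w) →
        ¬ (3 : ℤ) ∣ P.maninConstant →
        ∃ (c d a : ℤ) (A : ℕ) (d' : ℤ) (aM : ℕ → ℤ),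
          0 < A ∧ Int.gcd c (6 * 3 * A) = 1 ∧ Int.gcd d (6 * 3 * N) = 1 ∧
          (∀ q : ℕ, q.Prime → q ≡ 1 [MOD 3] → ¬ q ∣ 2 * c.natAbs * d.natAbs * A) ∧
          Int.gcd (c * d) A = 1 ∧ d * d' ≡ 1 [ZMOD (A : ℤ)] ∧ Nat.Coprime A N ∧
          (∀ q ∈ (3 * A).primeFactors, cuspCoeff P.f q = aM q) ∧
          (∏ q ∈ (3 * A).primeFactors,
              (1 - (aM q : ℚ) / q + (if q ∣ N then 0 else (1 / q : ℚ))) ≠ 0) ∧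
          padicValRat 3 (∏ q ∈ (3 * A).primeFactors,
              (1 - (aM q : ℚ) / q + (if q ∣ N then 0 else (1 / q : ℚ)))) = 0 ∧
          ((c : ℚ) ^ 2 * (d : ℚ) ^ 2 * ratMinusSymbol P.f ((a : ℚ) / A) -
              (c : ℚ) * (d : ℚ) ^ 2 * ratMinusSymbol P.f ((a * c : ℚ) / A) -
              (c : ℚ) ^ 2 * (d : ℚ) * ratMinusSymbol P.f ((a * d' : ℚ) / A) +
              (c : ℚ) * (d : ℚ) * ratMinusSymbol P.f ((a * c * d' : ℚ) / A) ≠ 0) ∧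
          padicValRat 3 ((c : ℚ) ^ 2 * (d : ℚ) ^ 2 * ratMinusSymbol P.f ((a : ℚ) / A) -
              (c : ℚ) * (d : ℚ) ^ 2 * ratMinusSymbol P.f ((a * c : ℚ) / A) -
              (c : ℚ) ^ 2 * (d : ℚ) * ratMinusSymbol P.f ((a * d' : ℚ) / A) +
              (c : ℚ) * (d : ℚ) * ratMinusSymbol P.f ((a * c * d' : ℚ) / A)) = 0) :
    Summit.BirchSwinnertonDyer.BirchSwinnertonDyer.Theses.KimAtThreeKolyvagin.KatoKuriharaPortThreeShared := by
  intro W _ _ htow hadd hc3 ht v₃ hv₃ η _ N _ P hN hlat hman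
  exact portShared_row_of_fineKato_of_certSupply hC1 hC2 W htow hadd hc3 ht v₃ hv₃ η P hN hlat hman

/-- **Crux `KatoKuriharaPortThreeShared` (stmt-BirchSwinnertonDyer-19560) BY NAME from the FINE KATO
PACKAGE (C1) ALONE**: (C2) is w2-c3 gen 4's class-wide theorem
(`KimAtThreePortSharedC2Supply.unitMinusSymbol_classwide` through kim3's
`certSupply_of_forall_unitMinusSymbol`), (C3) is gone (THEOREM D-u).  (C1) displayed — the crux's only
residual input; 19560 is NOT closed by this theorem.
[cite: Kato2004Asterisque, (8.1.3) (p. 180), Prop. 8.12 (p. 186), §9.4 and Thm. 9.7 (pp. 188–189), Thm. 6.6 (1) (p. 163), Ex. 13.3 (pp. 224–225)]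
[cite: MazurRubin2004, Thm. 3.2.4 and App. A Remark A.5] [cite: TateGCFT1967, §2.4 (Tchebotarev density theorem)] -/
theorem katoKuriharaPortThreeShared_of_fineKato
    (hC1 : ∀ (W : WeierstrassCurve ℚ) [W.IsElliptic] [W.IsGloballyMinimal]
      [ContinuousSMul ℤ_[3] (W.tateModule 3)] [Module.Free ℤ_[3] (W.tateModule 3)]
      [Module.Finite ℤ_[3] (W.tateModule 3)],
      (∀ m : ℕ, W.HasSurjectiveModNGaloisRep (3 ^ m : ℕ)) →
      (haveI : Fact (Nat.Prime 3) := ⟨Nat.prime_three⟩; Addv W 3) →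
      ¬ 3 ∣ (W.baseChange ℚ_[3]).localTamagawaNumber ℤ_[3] →
      Nat.card {Q : (W.baseChange ℚ_[3]).toAffine.Point // (3 : ℕ) • Q = 0} = 1 →
      ∀ (v₃ : HeightOneSpectrum (𝓞 ℚ)), ((3 : ℕ) : 𝓞 ℚ) ∈ v₃.asIdeal →
      ∀ {N : ℕ} [NeZero N] (P : ModularParametrizationData W N), N = W.conductorNorm ℤ →
        (∀ z ∈ P.L.lattice, ∃ w ∈ periodLattice P.f, z = P.c * w) →
        ¬ (3 : ℤ) ∣ P.maninConstant →
        ∃ (ι : (n : ℕ) → (CyclotomicField n ℚ →+* ℂ)) (κK : ℝ)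
          (Λ : ∀ (k' : ℕ) (r : Finset (HeightOneSpectrum (𝓞 ℚ))),
            H1 (tateRep W 3) (cycSubgroup 3 k' r) →ₗ[ℤ_[3]]
              ℚ_[3] ⊗[ℚ] CyclotomicField (cycLevel 3 k' r) ℚ)
          (Λfin : ∀ j : ℕ, galoisCohomology
            ((W.torsionGaloisModule (((3 : ℕ) : ℤ) ^ j * ((3 : ℕ) : ℤ))).toLocal (Sum.inr v₃)) 1 →+
              ZMod (3 ^ (j + 1))),
          κK ≠ 0 ∧ (∃ u : ℚ, (u : ℝ) = κK ∧ padicValRat 3 u = 0) ∧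
          (∀ j : ℕ, KatoExpStarFiniteLevelAt W 3 j 0 v₃ Λ (Λfin j)) ∧
          ∀ (c d a : ℤ) (A : ℕ), 0 < A → Int.gcd c (6 * 3 * A) = 1 → Int.gcd d (6 * 3 * N) = 1 →
            ∃ (z : ∀ (k' : ℕ) (r : (cyclotomicLevelsRat 3 (badPlaces c d A N)).Ideals),
                  H1 (tateRep W 3) ((cyclotomicLevelsRat 3 (badPlaces c d A N)).level k' r.1))
              (x : ∀ (k' : ℕ) (r : (cyclotomicLevelsRat 3 (badPlaces c d A N)).Ideals),
                  CyclotomicField (cycLevel 3 k' r.1) ℚ),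
              ZetaBody W 3 P.f ι κK Λ c d a A z x) :
    Summit.BirchSwinnertonDyer.BirchSwinnertonDyer.Theses.KimAtThreeKolyvagin.KatoKuriharaPortThreeShared :=
  katoKuriharaPortThreeShared_of_fineKato_of_certSupply hC1
    (KimAtThreeKolyvaginPortSharedCert.certSupply_of_forall_unitMinusSymbol
      KimAtThreePortSharedC2Supply.unitMinusSymbol_classwide)

end Summit.BirchSwinnertonDyer.BirchSwinnertonDyer.Theorems.KimAtThreeDeepUpperPortSharedOfFineKato

end
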